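import Literature.Probability.LatticeModels.RandomClusterLimitExistence
import HarnessLib

/-!
# Automorphism invariance of the infinite-volume random-cluster measures `φ^b_{p,q}` of `ℤ^d` (Grimmett 2006,
# Thm. (4.19)(b)): translations and the symmetries of the box; free and wired; every `d ≥ 1`

Topic `Literature/Probability/LatticeModels`; theorems only (no definitions, no named facts, no sorries).  Companion of
`RandomClusterInfiniteVolume.lean` (`IsRandomClusterLimit d b p q P`) and `RandomClusterLimitExistence.lean`
(Thm. (4.19)(a)); the tree's `ℤ²`/free/cylinder version is `FKLoopNestingMeasureInvariance.lean`.
Grimmett 2006, Thm. (4.19)(b), p. 77: "The probability measure `φ^b_{p,q}` is automorphism-invariant."  Proof (p. 78):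
for an increasing cylinder event `A` and a translation `τ`, `φ^b_{Λ}(τA) = φ^b_{τ⁻¹Λ}(A)` is sandwiched by (4.24) between
the values on two centred boxes, both tending to `φ^b_{p,q}(A)`; automorphisms fixing the origin preserve the boxes.
* `toLattice_preimage_eq_finsetRestrict_preimage'` (nested pieces), `relabel_toLattice`,
  `toLattice_preimage_relabel_preimage`, `rcLaw_real_preimage_relabel` (`φ^W_S(g⁻¹ A) = φ^{gW}_{S'}(A)`),
  `image_finsetGraphIso_wiredSet`; `measure_eq_of_forall_isUpperSet_isLocalEvent` (two finite measures agreeing on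
  increasing local events agree on all local events); `rcBoxLaw_real_preimage_relabel_shift`,
  `rcLaw_wired_icc_anti`, `rcLaw_free_mono` ((4.24) for the laws read on `ℤ^d`).
* **`IsRandomClusterLimit.map_relabel_shift`** (+ `measure_preimage_relabel_shift`, `measurePreserving_relabel_shift`,
  `measureReal_preimage_relabel_shift_of_isUpperSet`, `measure_preimage_relabel_shift_of_isLocalEvent`) — TRANSLATION
  INVARIANCE for `d ≥ 1`, `b ∈ {free, wired}`, `0 ≤ p ≤ 1`, `q ≥ 1`, `v ∈ ℤ^d`.
* **`IsRandomClusterLimit.map_relabel_signedPerm`** (+ applied forms) — invariance under the signed coordinate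
  permutations (`q > 0`).
[Grimmett2006: G. Grimmett, *The Random-Cluster Model*, Springer 2006, Thm. (4.19)(b), eq. (4.24), §4.3]
-/

noncomputable section

open MeasureTheory Filter Topology Set Literature.Probability.Percolation
open scoped ENNReal

namespace Literature.Probability.LatticeModels

variable {d : ℕ}

/-! ### Reading local events in nested pieces and through automorphisms -/

section Pieces

/-- The lattice image of a lifted edge is the lattice image of the edge. [folklore] -/
private theorem sym2Map_val_edgeLift' {Λ Δ : Finset (Site d)} (h : Λ ⊆ Δ) (e : Sym2 ↥Λ) :
    Sym2.map Subtype.val (edgeLift h e) = Sym2.map Subtype.val e := by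
  rw [edgeLift, Function.Embedding.sym2Map_apply, Sym2.map_map]
  rfl

/-- Restriction commutes with reading on the lattice, on windows inside the smaller piece. [folklore] -/
private theorem toLattice_finsetRestrict_inter' {Λ Δ : Finset (Site d)} (h : Λ ⊆ Δ) (ω : BondConfig ↥Δ)
    {J : Set (Sym2 (Site d))} (hJ : ∀ e ∈ J, ∀ x ∈ e, x ∈ Λ) :
    toLattice Λ (finsetRestrict h ω) ∩ J = toLattice Δ ω ∩ J := by
  ext e
  simp only [mem_inter_iff, mem_toLattice_iff, and_congr_left_iff]
  intro heJ
  constructor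
  · rintro ⟨e'', he'', rfl⟩
    exact ⟨edgeLift h e'', he'', sym2Map_val_edgeLift' _ _⟩
  · rintro ⟨e', he', rfl⟩
    induction e' using Sym2.ind with
    | h a b =>
      have ha : (a : Site d) ∈ Λ := hJ _ heJ _ (by simp)
      have hb : (b : Site d) ∈ Λ := hJ _ heJ _ (by simp)
      refine ⟨s(⟨a, ha⟩, ⟨b, hb⟩), ?_, ?_⟩
      · change edgeLift h s(⟨a, ha⟩, ⟨b, hb⟩) ∈ ω
        rw [edgeLift_mk]
        exact he'
      · simp

/-- A local event read in `Δ ⊇ Λ` is the pull-back of the event read in `Λ` when its window lies in `Λ`.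
[cite: Grimmett2006, Thm. (4.19)(a), proof] -/
theorem toLattice_preimage_eq_finsetRestrict_preimage' {Λ Δ : Finset (Site d)} (h : Λ ⊆ Δ)
    {A : Set (BondConfig (Site d))} {J : Set (Sym2 (Site d))} (hA : DeterminedBy A J)
    (hJ : ∀ e ∈ J, ∀ x ∈ e, x ∈ Λ) : toLattice Δ ⁻¹' A = finsetRestrict h ⁻¹' (toLattice Λ ⁻¹' A) := by
  ext ω
  simp only [mem_preimage]
  exact ((determinedBy_iff A J).1 hA _ _ (toLattice_finsetRestrict_inter' h ω hJ)).symm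

variable (g : zdGraph d ≃g zdGraph d) {S S' : Finset (Site d)} (hS : ∀ x, x ∈ S' ↔ g.symm x ∈ S)

/-- Reading on the lattice commutes with an automorphism `g`, `S' = g(S)`. [cite: Grimmett2006, §4.3] -/
theorem relabel_toLattice (ω : BondConfig ↥S) :
    BondConfig.relabel (sym2Equiv g.toEquiv) (toLattice S ω) =
      toLattice S' (BondConfig.relabel (sym2Equiv (finsetGraphIso g hS).toEquiv) ω) := by
  rw [BondConfig.relabel_apply, BondConfig.relabel_apply, toLattice, toLattice, Set.image_image, Set.image_image]
  refine Set.image_congr' fun e => ?_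
  rw [sym2Equiv_apply, sym2Equiv_apply, Sym2.map_map, Sym2.map_map]
  rfl

/-- Preimage form of `relabel_toLattice`. [cite: Grimmett2006, §4.3] -/
theorem toLattice_preimage_relabel_preimage (A : Set (BondConfig (Site d))) :
    toLattice S ⁻¹' (BondConfig.relabel (sym2Equiv g.toEquiv) ⁻¹' A) =
      BondConfig.relabel (sym2Equiv (finsetGraphIso g hS).toEquiv) ⁻¹' (toLattice S' ⁻¹' A) := by
  ext ω
  simp only [mem_preimage, relabel_toLattice g hS ω]

/-- `φ^W_S(g⁻¹A) = φ^{gW}_{S'}(A)` for the piece laws read on `ℤ^d`. [cite: Grimmett2006, §4.3] -/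
theorem rcLaw_real_preimage_relabel {p q : ℝ} (hp : p ∈ Set.Icc (0 : ℝ) 1) (hq : 0 < q) (W : Set ↥S)
    {A : Set (BondConfig (Site d))} (hA : MeasurableSet A) :
    (rcLaw d p q S W).real (BondConfig.relabel (sym2Equiv g.toEquiv) ⁻¹' A) =
      (rcLaw d p q S' ((finsetGraphIso g hS) '' W)).real A := by
  classical
  rw [rcLaw_real_apply p q S W ((BondConfig.relabel _).measurable hA), rcLaw_real_apply p q S' _ hA,
    toLattice_preimage_relabel_preimage g hS, rcMeasure_real_preimage_relabel (finsetGraphIso g hS) hp hq]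

/-- The wired sets transform correctly: `g(W^b_S) = W^b_{S'}`. [cite: Grimmett2006, §4.3] -/
theorem image_finsetGraphIso_wiredSet (b : RCBoundary) :
    (finsetGraphIso g hS) '' (b.wiredSet S) = b.wiredSet S' := by
  cases b
  · change (finsetGraphIso g hS) '' (∅ : Set ↥S) = ∅
    exact Set.image_empty _
  · exact image_finsetGraphIso_wiredBoundary g hS

end Pieces

/-! ### Agreement on increasing local events suffices -/

section UpperEnough

variable {ι : Type*}

/-- The window projection is monotone. [folklore] -/
private theorem windowProj_mono' (J : Finset ι) : Monotone (windowProj (ι := ι) J) := by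
  classical
  intro ω ω' hle j
  simp only [windowProj_apply, Bool.le_iff_imp, decide_eq_true_eq]
  exact fun hj => hle hj

/-- A pattern is the difference of two nested up-sets of patterns. [folklore] -/
private theorem singleton_eq_diff_upperSets' {J : Type*} (g : J → Bool) :
    ({g} : Set (J → Bool)) =
      {f | ∀ j, g j = true → f j = true} \ {f | (∀ j, g j = true → f j = true) ∧ ∃ j, g j = false ∧ f j = true} := by
  ext f
  simp only [mem_singleton_iff, Set.mem_sdiff, mem_setOf_eq, not_and, not_exists]
  constructor
  · rintro rfl
    exact ⟨fun j h => h, fun _ j h1 h2 => Bool.false_ne_true (h1.symm.trans h2)⟩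
  · rintro ⟨h1, h2⟩
    funext j
    cases hg : g j with
    | false =>
      cases hf : f j with
      | false => rfl
      | true => exact absurd hf (h2 h1 j hg)
    | true => exact h1 j hg

/-- Two finite measures on `Set ι` agreeing on increasing local events agree on all local events.
[cite: Grimmett2006, Thm. (4.19), proof of (a)] -/
theorem measure_eq_of_forall_isUpperSet_isLocalEvent (μ ν : Measure (Set ι)) [IsFiniteMeasure μ] [IsFiniteMeasure ν]
    (h : ∀ A : Set (Set ι), IsLocalEvent A → IsUpperSet A → μ A = ν A) {A : Set (Set ι)} (hA : IsLocalEvent A) :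
    μ A = ν A := by
  classical
  obtain ⟨J, hJ⟩ := hA
  set S : Set (J → Bool) := windowProj J '' A with hS
  have hAS : A = windowProj J ⁻¹' S := hJ.eq_preimage_windowProj
  set T : Finset (J → Bool) := S.toFinite.toFinset with hT
  have hSfin : S = ↑T := S.toFinite.coe_toFinset.symm
  have hAT : A = windowProj J ⁻¹' ↑T := by rw [hAS, hSfin]
  have hpat : ∀ g : J → Bool, μ (windowProj J ⁻¹' {g}) = ν (windowProj J ⁻¹' {g}) := by
    intro g
    set TU : Set (J → Bool) := {f | ∀ j, g j = true → f j = true} with hTU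
    set TV : Set (J → Bool) := {f | (∀ j, g j = true → f j = true) ∧ ∃ j, g j = false ∧ f j = true} with hTV
    have hTVU : TV ⊆ TU := fun f hf => hf.1
    have hTUup : IsUpperSet TU := fun f f' hff' hf j hj => by
      have := hff' j; rw [hf j hj] at this; exact top_le_iff.1 this
    have hTVup : IsUpperSet TV := fun f f' hff' hf =>
      ⟨hTUup hff' hf.1, by
        obtain ⟨j, hgj, hfj⟩ := hf.2
        have := hff' j; rw [hfj] at this
        exact ⟨j, hgj, top_le_iff.1 this⟩⟩
    have hU := h _ (isLocalEvent_preimage_windowProj J TU) (hTUup.preimage (windowProj_mono' J))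
    have hV := h _ (isLocalEvent_preimage_windowProj J TV) (hTVup.preimage (windowProj_mono' J))
    have hdiff : ∀ (ρ : Measure (Set ι)) [IsFiniteMeasure ρ], ρ (windowProj J ⁻¹' {g}) =
        ρ (windowProj J ⁻¹' TU) - ρ (windowProj J ⁻¹' TV) := fun ρ _ => by
      rw [singleton_eq_diff_upperSets' g, preimage_sdiff]
      exact measure_sdiff (preimage_mono hTVU) (measurable_windowProj J (Set.toFinite TV).measurableSet).nullMeasurableSet
        (measure_ne_top _ _)
    rw [hdiff μ, hdiff ν, hU, hV]
  rw [hAT, ← sum_measure_preimage_singleton T fun g _ => measurable_windowProj J (measurableSet_singleton g),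
    ← sum_measure_preimage_singleton T fun g _ => measurable_windowProj J (measurableSet_singleton g)]
  exact Finset.sum_congr rfl fun g _ => hpat g

end UpperEnough

/-! ### Translation invariance -/

section Shift

variable {b : RCBoundary} {p q : ℝ} {P : Measure (BondConfig (Site d))}

/-- `Λ_N + v` as a coordinate box. [folklore] -/
private theorem mem_icc_shift_iff' (N : ℕ) (v x : Site d) :
    x ∈ Finset.Icc (fun i => -(N : ℤ) + v i) (fun i => (N : ℤ) + v i) ↔ (zdShiftIso v).symm x ∈ box d N :=
  mem_icc_shift_iff N v x

/-- `φ^b_{Λ_N}(A − v) = φ^b_{Λ_N + v}(A)` (`ω ↦ ω + v` is `BondConfig.relabel (sym2Equiv (Site.shift v))`).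
[cite: Grimmett2006, Thm. (4.19)(b), proof] -/
theorem rcBoxLaw_real_preimage_relabel_shift (b : RCBoundary) (hp : p ∈ Set.Icc (0 : ℝ) 1) (hq : 0 < q) (N : ℕ)
    (v : Site d) {A : Set (BondConfig (Site d))} (hA : MeasurableSet A) :
    (rcBoxLaw d b p q N).real (BondConfig.relabel (sym2Equiv (Site.shift v)) ⁻¹' A) =
      (rcLaw d p q (Finset.Icc (fun i => -(N : ℤ) + v i) (fun i => (N : ℤ) + v i))
        (b.wiredSet (Finset.Icc (fun i => -(N : ℤ) + v i) (fun i => (N : ℤ) + v i)))).real A := by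
  have h := rcLaw_real_preimage_relabel (zdShiftIso v) (mem_icc_shift_iff' N v) hp hq (b.wiredSet (box d N)) hA
  rw [image_finsetGraphIso_wiredSet] at h
  exact h

/-- Box laws on the coordinate box `[-n,n]^d`. [folklore] -/
private theorem rcBoxLaw_eq_rcLaw_Icc (b : RCBoundary) (p q : ℝ) (n : ℕ) :
    rcBoxLaw d b p q n = rcLaw d p q (Finset.Icc (fun _ : Fin d => -(n : ℤ)) (fun _ => (n : ℤ)))
      (b.wiredSet (Finset.Icc (fun _ : Fin d => -(n : ℤ)) (fun _ => (n : ℤ)))) := by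
  unfold rcBoxLaw
  rw [box_eq_Icc']

/-- (4.24), wired, read on `ℤ^d`: `φ¹_{Δ}(A) ≤ φ¹_{Λ}(A)` for coordinate boxes `Λ ⊆ Δ`, `A` increasing local with
window in `Λ`. [cite: Grimmett2006, Thm. (4.19)(a), proof, eq. (4.24)] -/
theorem rcLaw_wired_icc_anti (hd : 0 < d) {a c a' c' : Site d} (hac : a ≤ c) (h : Finset.Icc a c ⊆ Finset.Icc a' c')
    (hp : p ∈ Set.Icc (0 : ℝ) 1) (hq : 1 ≤ q) {A : Set (BondConfig (Site d))} {J : Finset (Sym2 (Site d))}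
    (hA : DeterminedBy A ↑J) (hAup : IsUpperSet A) (hJ : ∀ e ∈ J, ∀ x ∈ e, x ∈ Finset.Icc a c) :
    (rcLaw d p q (Finset.Icc a' c') (wiredBoundary (zdGraph d) (Finset.Icc a' c'))).real A ≤
      (rcLaw d p q (Finset.Icc a c) (wiredBoundary (zdGraph d) (Finset.Icc a c))).real A := by
  have hAm : MeasurableSet A := measurableSet_of_isLocalEvent_holds ⟨J, hA⟩
  rw [rcLaw_real_apply p q _ _ hAm, rcLaw_real_apply p q _ _ hAm,
    toLattice_preimage_eq_finsetRestrict_preimage' h hA (fun e he x hx => hJ e he x hx)]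
  exact rcMeasure_real_icc_restrict_le h hd hac hp hq (IsUpperSet.preimage_toLattice hAup)

/-- (4.24), free, read on `ℤ^d`: `φ⁰_{Λ}(A) ≤ φ⁰_{Δ}(A)`. [cite: Grimmett2006, Thm. (4.19)(a), proof, eq. (4.24)] -/
theorem rcLaw_free_mono {Λ Δ : Finset (Site d)} (h : Λ ⊆ Δ) (hp : p ∈ Set.Icc (0 : ℝ) 1) (hq : 1 ≤ q)
    {A : Set (BondConfig (Site d))} {J : Finset (Sym2 (Site d))} (hA : DeterminedBy A ↑J) (hAup : IsUpperSet A)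
    (hJ : ∀ e ∈ J, ∀ x ∈ e, x ∈ Λ) :
    (rcLaw d p q Λ ∅).real A ≤ (rcLaw d p q Δ ∅).real A := by
  have hAm : MeasurableSet A := measurableSet_of_isLocalEvent_holds ⟨J, hA⟩
  rw [rcLaw_real_apply p q _ _ hAm, rcLaw_real_apply p q _ _ hAm,
    toLattice_preimage_eq_finsetRestrict_preimage' h hA (fun e he x hx => hJ e he x hx)]
  exact rcMeasure_real_free_le_restrict h hp hq (IsUpperSet.preimage_toLattice hAup)

/-- Every finite set of pairs of sites lies inside some box. [folklore] -/
private theorem exists_forall_mem_box' (J : Finset (Sym2 (Site d))) : ∃ m : ℕ, ∀ e ∈ J, ∀ x ∈ e, x ∈ box d m := by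
  classical
  have hfe : ∀ e : Sym2 (Site d), Set.Finite {x : Site d | x ∈ e} := fun e => by
    induction e using Sym2.ind with
    | h a b =>
      refine ((Set.finite_singleton b).insert a).subset fun x hx => ?_
      simp only [mem_setOf_eq, Sym2.mem_iff] at hx
      rcases hx with rfl | rfl <;> simp
  have hfin : Set.Finite {x : Site d | ∃ e ∈ J, x ∈ e} := by
    refine (J.finite_toSet.biUnion fun e _ => hfe e).subset fun x hx => ?_
    obtain ⟨e, he, hxe⟩ := hx
    exact mem_biUnion he hxe
  refine ⟨hfin.toFinset.sup siteRad, fun e he x hx => mem_box_iff_siteRad_le.2 ?_⟩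
  exact Finset.le_sup (f := siteRad) (hfin.mem_toFinset.2 ⟨e, he, hx⟩)

/-- Translation invariance on increasing local events (the sandwich `φ^b_{Λ_{N∓‖v‖}}(A) ≶ φ^b_{Λ_N}(A − v)`).
[cite: Grimmett2006, Thm. (4.19)(b), proof] -/
theorem IsRandomClusterLimit.measureReal_preimage_relabel_shift_of_isUpperSet (hd : 0 < d)
    (hP : IsRandomClusterLimit d b p q P) (hp : p ∈ Set.Icc (0 : ℝ) 1) (hq : 1 ≤ q) (v : Site d)
    {A : Set (BondConfig (Site d))} (hA : IsLocalEvent A) (hAup : IsUpperSet A) :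
    P.real (BondConfig.relabel (sym2Equiv (Site.shift v)) ⁻¹' A) = P.real A := by
  have hq0 : 0 < q := one_pos.trans_le hq
  obtain ⟨J, hAJ⟩ := hA
  obtain ⟨m, hJ⟩ := exists_forall_mem_box' J
  have hAm : MeasurableSet A := measurableSet_of_isLocalEvent_holds ⟨J, hAJ⟩
  have hAloc : IsLocalEvent A := ⟨J, hAJ⟩
  set a : ℕ → ℝ := fun n => (rcBoxLaw d b p q n).real A with ha
  set c : ℕ → ℝ := fun n => (rcBoxLaw d b p q n).real (BondConfig.relabel (sym2Equiv (Site.shift v)) ⁻¹' A) with hc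
  have hlim : Tendsto a atTop (𝓝 (P.real A)) := hP.tendsto_real hAloc
  have hlim' : Tendsto c atTop (𝓝 (P.real (BondConfig.relabel (sym2Equiv (Site.shift v)) ⁻¹' A))) :=
    hP.tendsto_real (hAloc.preimage_relabel (sym2Equiv (Site.shift v)))
  have hlo := hlim.comp (tendsto_add_atTop_nat (siteRad v))
  have hup := hlim.comp (tendsto_sub_atTop_nat (siteRad v))
  have hJbox : ∀ n, m ≤ n → ∀ e ∈ J, ∀ x ∈ e, x ∈ Finset.Icc (fun _ : Fin d => -(n : ℤ)) (fun _ => (n : ℤ)) :=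
    fun n hmn e he x hx => (box_eq_Icc' (d := d) n) ▸ box_mono d hmn (hJ e he x hx)
  have hJshift : ∀ N, m + siteRad v ≤ N →
      ∀ e ∈ J, ∀ x ∈ e, x ∈ Finset.Icc (fun i => -(N : ℤ) + v i) (fun i => (N : ℤ) + v i) := by
    intro N hN e he x hx
    have hsub := box_sub_subset_icc_shift (d := d) (n := N) (v := v) (by omega)
    exact hsub (box_mono d (by omega) (hJ e he x hx))
  have hin : ∀ N, siteRad v ≤ N → Finset.Icc (fun _ : Fin d => -((N - siteRad v : ℕ) : ℤ))
      (fun _ => ((N - siteRad v : ℕ) : ℤ)) ⊆ Finset.Icc (fun i => -(N : ℤ) + v i) (fun i => (N : ℤ) + v i) :=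
    fun N hvN => (box_eq_Icc' (d := d) (N - siteRad v)) ▸ box_sub_subset_icc_shift hvN
  have hout : ∀ N : ℕ, Finset.Icc (fun i => -(N : ℤ) + v i) (fun i => (N : ℤ) + v i) ⊆
      Finset.Icc (fun _ : Fin d => -((N + siteRad v : ℕ) : ℤ)) (fun _ => ((N + siteRad v : ℕ) : ℤ)) :=
    fun N => (box_eq_Icc' (d := d) (N + siteRad v)) ▸ icc_shift_subset_box_add N v
  have hconv : Tendsto c atTop (𝓝 (P.real A)) := by
    cases b with
    | wired =>
      refine tendsto_of_tendsto_of_tendsto_of_le_of_le' hlo hup ?_ ?_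
      · filter_upwards [eventually_ge_atTop (m + siteRad v)] with N hN
        simp only [Function.comp_apply, ha, hc]
        rw [rcBoxLaw_real_preimage_relabel_shift _ hp hq0 N v hAm, rcBoxLaw_eq_rcLaw_Icc _ p q (N + siteRad v),
          RCBoundary.wiredSet_wired, RCBoundary.wiredSet_wired]
        exact rcLaw_wired_icc_anti hd (fun i => by simp) (hout N) hp hq hAJ hAup (hJshift N hN)
      · filter_upwards [eventually_ge_atTop (m + siteRad v)] with N hN
        simp only [Function.comp_apply, ha, hc]
        rw [rcBoxLaw_real_preimage_relabel_shift _ hp hq0 N v hAm, rcBoxLaw_eq_rcLaw_Icc _ p q (N - siteRad v),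
          RCBoundary.wiredSet_wired, RCBoundary.wiredSet_wired]
        exact rcLaw_wired_icc_anti hd (fun i => by simp) (hin N (by omega)) hp hq hAJ hAup (hJbox _ (by omega))
    | free =>
      refine tendsto_of_tendsto_of_tendsto_of_le_of_le' hup hlo ?_ ?_
      · filter_upwards [eventually_ge_atTop (m + siteRad v)] with N hN
        simp only [Function.comp_apply, ha, hc]
        rw [rcBoxLaw_real_preimage_relabel_shift _ hp hq0 N v hAm, rcBoxLaw_eq_rcLaw_Icc _ p q (N - siteRad v)]
        exact rcLaw_free_mono (hin N (by omega)) hp hq hAJ hAup (hJbox _ (by omega))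
      · filter_upwards [eventually_ge_atTop (m + siteRad v)] with N hN
        simp only [Function.comp_apply, ha, hc]
        rw [rcBoxLaw_real_preimage_relabel_shift _ hp hq0 N v hAm, rcBoxLaw_eq_rcLaw_Icc _ p q (N + siteRad v)]
        exact rcLaw_free_mono (hout N) hp hq hAJ hAup (hJshift N hN)
  exact tendsto_nhds_unique hlim' hconv

/-- **Translation invariance on all local events.** [cite: Grimmett2006, Thm. (4.19)(b)] -/
theorem IsRandomClusterLimit.measure_preimage_relabel_shift_of_isLocalEvent (hd : 0 < d)
    (hP : IsRandomClusterLimit d b p q P) (hp : p ∈ Set.Icc (0 : ℝ) 1) (hq : 1 ≤ q) (v : Site d)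
    {A : Set (BondConfig (Site d))} (hA : IsLocalEvent A) :
    P (BondConfig.relabel (sym2Equiv (Site.shift v)) ⁻¹' A) = P A := by
  haveI := hP.isProbabilityMeasure
  haveI : IsProbabilityMeasure (P.map (BondConfig.relabel (sym2Equiv (Site.shift v)))) :=
    Measure.isProbabilityMeasure_map (MeasurableEquiv.measurable _).aemeasurable
  have h := measure_eq_of_forall_isUpperSet_isLocalEvent (P.map (BondConfig.relabel (sym2Equiv (Site.shift v)))) P
    (fun B hB hBup => by
      rw [MeasurableEquiv.map_apply]
      have h := hP.measureReal_preimage_relabel_shift_of_isUpperSet hd hp hq v hB hBup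
      rw [measureReal_def, measureReal_def, ENNReal.toReal_eq_toReal_iff' (measure_ne_top _ _) (measure_ne_top _ _)] at h
      exact h) hA
  rw [MeasurableEquiv.map_apply] at h
  exact h

/-- **Grimmett 2006, Thm. (4.19)(b), translations** (`d ≥ 1`, free or wired, `0 ≤ p ≤ 1`, `q ≥ 1`): the image of
`P = φ^b_{p,q}` under `ω ↦ ω + v` is `P`. [cite: Grimmett2006, Thm. (4.19)(b)] -/
theorem IsRandomClusterLimit.map_relabel_shift (hd : 0 < d) (hP : IsRandomClusterLimit d b p q P)
    (hp : p ∈ Set.Icc (0 : ℝ) 1) (hq : 1 ≤ q) (v : Site d) :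
    P.map (BondConfig.relabel (sym2Equiv (Site.shift v))) = P := by
  haveI := hP.isProbabilityMeasure
  haveI : IsProbabilityMeasure (P.map (BondConfig.relabel (sym2Equiv (Site.shift v)))) :=
    Measure.isProbabilityMeasure_map (MeasurableEquiv.measurable _).aemeasurable
  refine ext_of_isLocalEvent fun A hA => ?_
  rw [MeasurableEquiv.map_apply]
  exact hP.measure_preimage_relabel_shift_of_isLocalEvent hd hp hq v hA

/-- Applied form: `P{ω | ω + v ∈ A} = P(A)` for EVERY event `A`. [cite: Grimmett2006, Thm. (4.19)(b)] -/
theorem IsRandomClusterLimit.measure_preimage_relabel_shift (hd : 0 < d) (hP : IsRandomClusterLimit d b p q P)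
    (hp : p ∈ Set.Icc (0 : ℝ) 1) (hq : 1 ≤ q) (v : Site d) (A : Set (BondConfig (Site d))) :
    P (BondConfig.relabel (sym2Equiv (Site.shift v)) ⁻¹' A) = P A := by
  conv_rhs => rw [← hP.map_relabel_shift hd hp hq v, MeasurableEquiv.map_apply]

/-- **The shift `ω ↦ ω + v` preserves `φ^b_{p,q}`** (the translation-invariance field of the tree's `IsFKGibbs`).
[cite: Grimmett2006, Thm. (4.19)(b)] -/
theorem IsRandomClusterLimit.measurePreserving_relabel_shift (hd : 0 < d) (hP : IsRandomClusterLimit d b p q P)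
    (hp : p ∈ Set.Icc (0 : ℝ) 1) (hq : 1 ≤ q) (v : Site d) :
    MeasurePreserving (BondConfig.relabel (sym2Equiv (Site.shift v))) P P :=
  ⟨MeasurableEquiv.measurable _, hP.map_relabel_shift hd hp hq v⟩

end Shift

/-! ### Invariance under the symmetries of the box -/

section SignedPerm

variable {b : RCBoundary} {p q : ℝ} {P : Measure (BondConfig (Site d))}

/-- A signed coordinate permutation preserves every box law: `φ^b_{Λ_N}(σ⁻¹ A) = φ^b_{Λ_N}(A)`.
[cite: Grimmett2006, Thm. (4.19)(b), proof] -/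
theorem rcBoxLaw_real_preimage_relabel_signedPerm (b : RCBoundary) (hp : p ∈ Set.Icc (0 : ℝ) 1) (hq : 0 < q)
    (N : ℕ) (π : Equiv.Perm (Fin d)) (ε : Fin d → ℤˣ) {A : Set (BondConfig (Site d))} (hA : MeasurableSet A) :
    (rcBoxLaw d b p q N).real (BondConfig.relabel (sym2Equiv (Site.signedPerm π ε)) ⁻¹' A) =
      (rcBoxLaw d b p q N).real A := by
  have h := rcLaw_real_preimage_relabel (zdSignedPermIso π ε) (mem_box_iff_signedPerm_symm_mem π ε N) hp hq
    (b.wiredSet (box d N)) hA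
  rw [image_finsetGraphIso_wiredSet] at h
  exact h

/-- **Grimmett 2006, Thm. (4.19)(b), symmetries of the box** (`q > 0`). [cite: Grimmett2006, Thm. (4.19)(b)] -/
theorem IsRandomClusterLimit.map_relabel_signedPerm (hP : IsRandomClusterLimit d b p q P) (hp : p ∈ Set.Icc (0 : ℝ) 1)
    (hq : 0 < q) (π : Equiv.Perm (Fin d)) (ε : Fin d → ℤˣ) :
    P.map (BondConfig.relabel (sym2Equiv (Site.signedPerm π ε))) = P := by
  haveI := hP.isProbabilityMeasure
  haveI : IsProbabilityMeasure (P.map (BondConfig.relabel (sym2Equiv (Site.signedPerm π ε)))) :=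
    Measure.isProbabilityMeasure_map (MeasurableEquiv.measurable _).aemeasurable
  refine ext_of_isLocalEvent fun A hA => ?_
  rw [MeasurableEquiv.map_apply]
  have hA' : IsLocalEvent (BondConfig.relabel (sym2Equiv (Site.signedPerm π ε)) ⁻¹' A) :=
    hA.preimage_relabel (sym2Equiv (Site.signedPerm π ε))
  refine tendsto_nhds_unique (hP.tendsto_isLocalEvent _ hA') ?_
  refine (hP.tendsto_isLocalEvent A hA).congr fun N => ?_
  have h := rcBoxLaw_real_preimage_relabel_signedPerm b hp hq N π ε (measurableSet_of_isLocalEvent_holds hA)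
  haveI := isProbabilityMeasure_rcBoxLaw (d := d) b hp hq N
  rw [measureReal_def, measureReal_def, ENNReal.toReal_eq_toReal_iff' (measure_ne_top _ _) (measure_ne_top _ _)] at h
  exact h.symm

/-- Applied form: `P{ω | σ ω ∈ A} = P(A)` for every event. [cite: Grimmett2006, Thm. (4.19)(b)] -/
theorem IsRandomClusterLimit.measure_preimage_relabel_signedPerm (hP : IsRandomClusterLimit d b p q P)
    (hp : p ∈ Set.Icc (0 : ℝ) 1) (hq : 0 < q) (π : Equiv.Perm (Fin d)) (ε : Fin d → ℤˣ)
    (A : Set (BondConfig (Site d))) : P (BondConfig.relabel (sym2Equiv (Site.signedPerm π ε)) ⁻¹' A) = P A := by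
  conv_rhs => rw [← hP.map_relabel_signedPerm hp hq π ε, MeasurableEquiv.map_apply]

/-- The symmetry `σ` preserves `φ^b_{p,q}`. [cite: Grimmett2006, Thm. (4.19)(b)] -/
theorem IsRandomClusterLimit.measurePreserving_relabel_signedPerm (hP : IsRandomClusterLimit d b p q P)
    (hp : p ∈ Set.Icc (0 : ℝ) 1) (hq : 0 < q) (π : Equiv.Perm (Fin d)) (ε : Fin d → ℤˣ) :
    MeasurePreserving (BondConfig.relabel (sym2Equiv (Site.signedPerm π ε))) P P :=
  ⟨MeasurableEquiv.measurable _, hP.map_relabel_signedPerm hp hq π ε⟩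

end SignedPerm

end Literature.Probability.LatticeModels
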